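import Summits.ResolutionOfSingularities.ResolutionOfSingularities.Theses.UniversalCells

/-!
# Crux `Universality` (stmt-ResolutionOfSingularities-15234) — `IsIntegral Y` cannot be weakened to `IsReduced Y`

Route `ResolutionOfSingularities/UniversalCells`, crux #7 `Universality`. Companion of
`Negative/FalseWithoutIsIntegral.lean` (p152095, witness a NON-REDUCED point): here the witness is
REDUCED but REDUCIBLE at `y`, showing that the irreducibility half of `IsIntegral Y` is load-bearing as
well: `universality_false_with_isReduced_for_isIntegral` proves that the crux with `IsIntegral Y`
REPLACED by `IsReduced Y` (everything else verbatim) is FALSE.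

Witness: `p = 2`, `Y = Spec 𝔽₂[x, y]/(xy)` (the node: affine, finite type, reduced), `y₀ =` the origin.
If `W ∋ w` is integral and open in `𝔸ˢ_Y` with `w ↦ y₀`, the stalk `𝒪_{𝔸ˢ_Y, j w} ≅ 𝒪_{W, w}` is a
domain; but it is the localisation of `A = (𝔽₂[x, y]/(xy))[t₁..t_s]` at a prime `𝔮` lying over the
origin, so `x̄, ȳ ∈ 𝔮`, `x̄ · ȳ = 0`, and neither dies in `A_𝔮` (the annihilator of `x̄` is `(ȳ) ⊆ 𝔮`):
`A_𝔮` has zero-divisors. Moral for provers/planners: the exact load-bearing content of `IsIntegral Y`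
is "`𝒪_{Y,y}` is a domain" (reduced AND irreducible at `y`); a reduced `Y` with `y` on two components
admits no chart. No definitions, no facts; kernel-only (cdisprove seat
refuter-cdisprove-stmt-ResolutionOfSingularities-15234-0, 2026-08-17).
-/

noncomputable section

-- single-problem summit: the doubled namespace component `ResolutionOfSingularities` is forced
set_option linter.dupNamespace false

open CategoryTheory AlgebraicGeometry

namespace Summit.ResolutionOfSingularities.ResolutionOfSingularities.Theorems.Universality.Negative

/-- `(xy)` is a radical ideal of `𝔽₂[x, y]`. [folklore] -/
theorem isRadical_span_X_mul_X :
    (Ideal.span {(MvPolynomial.X 0 * MvPolynomial.X 1 : MvPolynomial (Fin 2) (ZMod 2))}).IsRadical := by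
  have p0 : Prime (MvPolynomial.X (0 : Fin 2) : MvPolynomial (Fin 2) (ZMod 2)) := MvPolynomial.X_prime
  have p1 : Prime (MvPolynomial.X (1 : Fin 2) : MvPolynomial (Fin 2) (ZMod 2)) := MvPolynomial.X_prime
  intro r ⟨n, hn⟩
  rw [Ideal.mem_span_singleton] at hn ⊢
  have h0 : (MvPolynomial.X 0 : MvPolynomial (Fin 2) (ZMod 2)) ∣ r :=
    p0.dvd_of_dvd_pow (dvd_trans (dvd_mul_right _ _) hn)
  have h1 : (MvPolynomial.X 1 : MvPolynomial (Fin 2) (ZMod 2)) ∣ r :=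
    p1.dvd_of_dvd_pow (dvd_trans (dvd_mul_left _ _) hn)
  obtain ⟨r', rfl⟩ := h0
  have h1' : (MvPolynomial.X 1 : MvPolynomial (Fin 2) (ZMod 2)) ∣ r' := by
    rcases p1.dvd_or_dvd h1 with h | h
    · exact absurd (MvPolynomial.X_dvd_X.mp h) (by decide)
    · exact h
  obtain ⟨r'', rfl⟩ := h1'
  exact ⟨r'', by ring⟩

/-- The node ring `𝔽₂[x, y]/(xy)` is reduced. [folklore] -/
theorem isReduced_nodeRing : _root_.IsReduced (MvPolynomial (Fin 2) (ZMod 2) ⧸ Ideal.span {(MvPolynomial.X 0 * MvPolynomial.X 1 : MvPolynomial (Fin 2) (ZMod 2))}) :=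
  (Ideal.isRadical_iff_quotient_reduced _).mp isRadical_span_X_mul_X

/-- In the node ring, the annihilator of `x̄` is contained in `(ȳ)`. [folklore] -/
theorem mem_span_of_mul_mk_X_zero (n : (MvPolynomial (Fin 2) (ZMod 2) ⧸ Ideal.span {(MvPolynomial.X 0 * MvPolynomial.X 1 : MvPolynomial (Fin 2) (ZMod 2))}))
    (h : n * Ideal.Quotient.mk _ (MvPolynomial.X 0) = 0) :
    n ∈ Ideal.span {Ideal.Quotient.mk _ (MvPolynomial.X 1 : MvPolynomial (Fin 2) (ZMod 2))} := by
  obtain ⟨ñ, rfl⟩ := Ideal.Quotient.mk_surjective n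
  rw [← map_mul, Ideal.Quotient.eq_zero_iff_mem, Ideal.mem_span_singleton] at h
  obtain ⟨q, hq⟩ := h
  have hx : (MvPolynomial.X 0 : MvPolynomial (Fin 2) (ZMod 2)) ≠ 0 := MvPolynomial.X_ne_zero _
  have : ñ = MvPolynomial.X 1 * q := by
    apply mul_left_cancel₀ hx
    calc MvPolynomial.X 0 * ñ = ñ * MvPolynomial.X 0 := mul_comm _ _
      _ = MvPolynomial.X 0 * MvPolynomial.X 1 * q := hq
      _ = MvPolynomial.X 0 * (MvPolynomial.X 1 * q) := mul_assoc _ _ _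
  rw [this, map_mul]
  exact Ideal.mul_mem_right _ _ (Ideal.subset_span rfl)

/-- Symmetrically, the annihilator of `ȳ` is contained in `(x̄)`. [folklore] -/
theorem mem_span_of_mul_mk_X_one (n : (MvPolynomial (Fin 2) (ZMod 2) ⧸ Ideal.span {(MvPolynomial.X 0 * MvPolynomial.X 1 : MvPolynomial (Fin 2) (ZMod 2))}))
    (h : n * Ideal.Quotient.mk _ (MvPolynomial.X 1) = 0) :
    n ∈ Ideal.span {Ideal.Quotient.mk _ (MvPolynomial.X 0 : MvPolynomial (Fin 2) (ZMod 2))} := by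
  obtain ⟨ñ, rfl⟩ := Ideal.Quotient.mk_surjective n
  rw [← map_mul, Ideal.Quotient.eq_zero_iff_mem, Ideal.mem_span_singleton] at h
  obtain ⟨q, hq⟩ := h
  have hy : (MvPolynomial.X 1 : MvPolynomial (Fin 2) (ZMod 2)) ≠ 0 := MvPolynomial.X_ne_zero _
  have : ñ = MvPolynomial.X 0 * q := by
    apply mul_left_cancel₀ hy
    calc MvPolynomial.X 1 * ñ = ñ * MvPolynomial.X 1 := mul_comm _ _
      _ = MvPolynomial.X 0 * MvPolynomial.X 1 * q := hq
      _ = MvPolynomial.X 1 * (MvPolynomial.X 0 * q) := by ring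
  rw [this, map_mul]
  exact Ideal.mul_mem_right _ _ (Ideal.subset_span rfl)

/-- No localisation of `(𝔽₂[x,y]/(xy))[t₁..t_s]` at a prime containing `x̄` and `ȳ` is a domain.
[folklore] -/
theorem not_isDomain_localization_atPrime_node {σ : Type}
    (P : Ideal (MvPolynomial σ (MvPolynomial (Fin 2) (ZMod 2) ⧸ Ideal.span {(MvPolynomial.X 0 * MvPolynomial.X 1 : MvPolynomial (Fin 2) (ZMod 2))}))) [P.IsPrime]
    (hx : MvPolynomial.C (Ideal.Quotient.mk _ (MvPolynomial.X 0)) ∈ P)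
    (hy : MvPolynomial.C (Ideal.Quotient.mk _ (MvPolynomial.X 1)) ∈ P) :
    ¬ IsDomain (Localization.AtPrime P) := by
  intro hD
  -- generic step: if `C c` dies in the localisation while `ann(c) ⊆ (c')` and `C c' ∈ P`, contradiction
  have key : ∀ (c c' : (MvPolynomial (Fin 2) (ZMod 2) ⧸ Ideal.span {(MvPolynomial.X 0 * MvPolynomial.X 1 : MvPolynomial (Fin 2) (ZMod 2))})), (∀ n : (MvPolynomial (Fin 2) (ZMod 2) ⧸ Ideal.span {(MvPolynomial.X 0 * MvPolynomial.X 1 : MvPolynomial (Fin 2) (ZMod 2))}), n * c = 0 → n ∈ Ideal.span {c'}) →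
      MvPolynomial.C c' ∈ P →
      algebraMap (MvPolynomial σ (MvPolynomial (Fin 2) (ZMod 2) ⧸ Ideal.span {(MvPolynomial.X 0 * MvPolynomial.X 1 : MvPolynomial (Fin 2) (ZMod 2))})) (Localization.AtPrime P) (MvPolynomial.C c) = 0 → False := by
    intro c c' hann hc' hc
    obtain ⟨⟨q, hq⟩, hq0⟩ :=
      (IsLocalization.map_eq_zero_iff P.primeCompl (Localization.AtPrime P) _).mp hc
    apply hq
    have hq0' : MvPolynomial.C c * q = 0 := (mul_comm _ _).trans hq0
    have hcoeff : ∀ d, (q.coeff d) ∈ Ideal.span {c'} := fun d => by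
      apply hann
      have hd := congrArg (MvPolynomial.coeff d) hq0'
      rw [MvPolynomial.coeff_C_mul, MvPolynomial.coeff_zero] at hd
      exact (mul_comm _ _).trans hd
    have hqmem : q ∈ Ideal.map (MvPolynomial.C : (MvPolynomial (Fin 2) (ZMod 2) ⧸ Ideal.span {(MvPolynomial.X 0 * MvPolynomial.X 1 : MvPolynomial (Fin 2) (ZMod 2))}) →+* MvPolynomial σ (MvPolynomial (Fin 2) (ZMod 2) ⧸ Ideal.span {(MvPolynomial.X 0 * MvPolynomial.X 1 : MvPolynomial (Fin 2) (ZMod 2))}))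
        (Ideal.span {c'}) :=
      MvPolynomial.mem_map_C_iff.mpr hcoeff
    rw [Ideal.map_span, Set.image_singleton] at hqmem
    exact (Ideal.span_le.mpr (Set.singleton_subset_iff.mpr hc')) hqmem
  have hxy : (Ideal.Quotient.mk _ (MvPolynomial.X 0) : (MvPolynomial (Fin 2) (ZMod 2) ⧸ Ideal.span {(MvPolynomial.X 0 * MvPolynomial.X 1 : MvPolynomial (Fin 2) (ZMod 2))})) * Ideal.Quotient.mk _ (MvPolynomial.X 1) = 0 := by
    rw [← map_mul, Ideal.Quotient.eq_zero_iff_mem]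
    exact Ideal.subset_span rfl
  have h0 : algebraMap (MvPolynomial σ (MvPolynomial (Fin 2) (ZMod 2) ⧸ Ideal.span {(MvPolynomial.X 0 * MvPolynomial.X 1 : MvPolynomial (Fin 2) (ZMod 2))})) (Localization.AtPrime P)
        (MvPolynomial.C (Ideal.Quotient.mk _ (MvPolynomial.X 0))) *
      algebraMap (MvPolynomial σ (MvPolynomial (Fin 2) (ZMod 2) ⧸ Ideal.span {(MvPolynomial.X 0 * MvPolynomial.X 1 : MvPolynomial (Fin 2) (ZMod 2))})) (Localization.AtPrime P)
        (MvPolynomial.C (Ideal.Quotient.mk _ (MvPolynomial.X 1))) = 0 := by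
    rw [← map_mul, ← MvPolynomial.C_mul, hxy, MvPolynomial.C_0, map_zero]
  rcases mul_eq_zero.mp h0 with h | h
  · exact key _ _ (fun n hn => mem_span_of_mul_mk_X_zero n hn) hy h
  · exact key _ _ (fun n hn => mem_span_of_mul_mk_X_one n hn) hx h

/-- No INTEGRAL scheme is open in affine space over the node with a point over the origin.
[folklore] -/
theorem false_of_isOpenImmersion_affineSpace_node (s : ℕ) {W : Scheme.{0}}
    (j : W ⟶ 𝔸(Fin s; Spec (.of (MvPolynomial (Fin 2) (ZMod 2) ⧸ Ideal.span {(MvPolynomial.X 0 * MvPolynomial.X 1 : MvPolynomial (Fin 2) (ZMod 2))})))) [IsOpenImmersion j] [IsIntegral W] (w : W)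
    (y₀ : PrimeSpectrum (MvPolynomial (Fin 2) (ZMod 2) ⧸ Ideal.span {(MvPolynomial.X 0 * MvPolynomial.X 1 : MvPolynomial (Fin 2) (ZMod 2))}))
    (hx₀ : Ideal.Quotient.mk _ (MvPolynomial.X 0) ∈ y₀.asIdeal)
    (hy₀ : Ideal.Quotient.mk _ (MvPolynomial.X 1) ∈ y₀.asIdeal)
    (hw : (𝔸(Fin s; Spec (.of (MvPolynomial (Fin 2) (ZMod 2) ⧸ Ideal.span {(MvPolynomial.X 0 * MvPolynomial.X 1 : MvPolynomial (Fin 2) (ZMod 2))}))) ↘ Spec (.of (MvPolynomial (Fin 2) (ZMod 2) ⧸ Ideal.span {(MvPolynomial.X 0 * MvPolynomial.X 1 : MvPolynomial (Fin 2) (ZMod 2))}))).base (j.base w) = y₀) : False := by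
  let A : CommRingCat.{0} := .of (MvPolynomial (Fin s) (MvPolynomial (Fin 2) (ZMod 2) ⧸ Ideal.span {(MvPolynomial.X 0 * MvPolynomial.X 1 : MvPolynomial (Fin 2) (ZMod 2))}))
  let e : 𝔸(Fin s; Spec (.of (MvPolynomial (Fin 2) (ZMod 2) ⧸ Ideal.span {(MvPolynomial.X 0 * MvPolynomial.X 1 : MvPolynomial (Fin 2) (ZMod 2))}))) ≅ Spec A := AffineSpace.SpecIso (Fin s) (.of (MvPolynomial (Fin 2) (ZMod 2) ⧸ Ideal.span {(MvPolynomial.X 0 * MvPolynomial.X 1 : MvPolynomial (Fin 2) (ZMod 2))}))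
  let j' : W ⟶ Spec A := j ≫ e.hom
  let z : Spec A := j'.base w
  -- `z` lies over the origin
  have hz : (e.inv ≫ (𝔸(Fin s; Spec (.of (MvPolynomial (Fin 2) (ZMod 2) ⧸ Ideal.span {(MvPolynomial.X 0 * MvPolynomial.X 1 : MvPolynomial (Fin 2) (ZMod 2))}))) ↘ Spec (.of (MvPolynomial (Fin 2) (ZMod 2) ⧸ Ideal.span {(MvPolynomial.X 0 * MvPolynomial.X 1 : MvPolynomial (Fin 2) (ZMod 2))})))).base z = y₀ := by
    rw [Scheme.Hom.comp_apply]
    change (𝔸(Fin s; Spec (.of (MvPolynomial (Fin 2) (ZMod 2) ⧸ Ideal.span {(MvPolynomial.X 0 * MvPolynomial.X 1 : MvPolynomial (Fin 2) (ZMod 2))}))) ↘ Spec (.of (MvPolynomial (Fin 2) (ZMod 2) ⧸ Ideal.span {(MvPolynomial.X 0 * MvPolynomial.X 1 : MvPolynomial (Fin 2) (ZMod 2))}))).base (e.inv.base (e.hom.base (j.base w)))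
      = y₀
    rw [Scheme.hom_inv_apply]
    exact hw
  have hfinal : (Spec.map (CommRingCat.ofHom
      (MvPolynomial.C : (MvPolynomial (Fin 2) (ZMod 2) ⧸ Ideal.span {(MvPolynomial.X 0 * MvPolynomial.X 1 : MvPolynomial (Fin 2) (ZMod 2))}) →+* MvPolynomial (Fin s) (MvPolynomial (Fin 2) (ZMod 2) ⧸ Ideal.span {(MvPolynomial.X 0 * MvPolynomial.X 1 : MvPolynomial (Fin 2) (ZMod 2))})))).base z = y₀ :=
    (congrArg (fun φ => φ.base z)
      (AffineSpace.SpecIso_inv_over (n := Fin s) (R := CommRingCat.of (MvPolynomial (Fin 2) (ZMod 2) ⧸ Ideal.span {(MvPolynomial.X 0 * MvPolynomial.X 1 : MvPolynomial (Fin 2) (ZMod 2))})))).symm.trans hz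
  have hz' : Ideal.comap (MvPolynomial.C : (MvPolynomial (Fin 2) (ZMod 2) ⧸ Ideal.span {(MvPolynomial.X 0 * MvPolynomial.X 1 : MvPolynomial (Fin 2) (ZMod 2))}) →+* MvPolynomial (Fin s) (MvPolynomial (Fin 2) (ZMod 2) ⧸ Ideal.span {(MvPolynomial.X 0 * MvPolynomial.X 1 : MvPolynomial (Fin 2) (ZMod 2))})) z.asIdeal
      = y₀.asIdeal := by
    have h := congrArg PrimeSpectrum.asIdeal hfinal
    exact h
  have hx : MvPolynomial.C (Ideal.Quotient.mk _ (MvPolynomial.X 0)) ∈ z.asIdeal := by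
    have := hx₀
    rw [← hz', Ideal.mem_comap] at this
    exact this
  have hy : MvPolynomial.C (Ideal.Quotient.mk _ (MvPolynomial.X 1)) ∈ z.asIdeal := by
    have := hy₀
    rw [← hz', Ideal.mem_comap] at this
    exact this
  -- the stalk at `z` is a domain
  let e₁ : (Spec A).presheaf.stalk z ≃+* W.presheaf.stalk w :=
    (asIso (j'.stalkMap w)).commRingCatIsoToRingEquiv
  haveI : IsDomain ((Spec A).presheaf.stalk z) := e₁.injective.isDomain e₁.toRingHom
  let e₂ : (Spec A).presheaf.stalk z ≃+* Localization.AtPrime z.asIdeal :=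
    (Spec.stalkIso A z).commRingCatIsoToRingEquiv
  have hD : IsDomain (Localization.AtPrime z.asIdeal) := e₂.symm.injective.isDomain e₂.symm.toRingHom
  exact not_isDomain_localization_atPrime_node (σ := Fin s) z.asIdeal hx hy hD

/-- **`IsIntegral Y` cannot be weakened to `IsReduced Y` in `UniversalCells.Universality`.** The crux
with the hypothesis `AlgebraicGeometry.IsIntegral Y` REPLACED by `AlgebraicGeometry.IsReduced Y` (nothing
else changed) is FALSE. Witness: `p = 2`, the node `Y = Spec 𝔽₂[x, y]/(xy)` (affine — separated,
quasi-compact — of finite type and reduced), `y =` the origin: by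
`false_of_isOpenImmersion_affineSpace_node` no integral `W` open in `𝔸ˢ_Y` has a point over the origin.
[folklore] -/
theorem universality_false_with_isReduced_for_isIntegral :
    ¬ (∀ p : ℕ, p.Prime → ∀ (Y : AlgebraicGeometry.Scheme.{0}) (f : Y ⟶ AlgebraicGeometry.Spec (.of (ZMod p))), AlgebraicGeometry.IsSeparated f → AlgebraicGeometry.LocallyOfFiniteType f → AlgebraicGeometry.QuasiCompact f → AlgebraicGeometry.IsReduced Y → ∀ y : Y, ∃ (m : ℕ) (Γp : Finset (Fin 3 → Fin 3 ⊕ Fin m)) (Γ0 : Set (Fin 3 → Fin 3 ⊕ Fin m)) (s : ℕ) (W : AlgebraicGeometry.Scheme.{0}) (j : W ⟶ AlgebraicGeometry.AffineSpace (Fin s) Y) (w : W), let M : Matrix (Fin 3) (Fin 3 ⊕ Fin m) (MvPolynomial (Fin 3 × Fin m) (ZMod p)) := Matrix.fromCols 1 (Matrix.of fun i j => MvPolynomial.X (i, j)); let I : Ideal (MvPolynomial (Fin 3 × Fin m) (ZMod p)) := Ideal.span ((fun u : Fin 3 → Fin 3 ⊕ Fin m => (M.submatrix id u).det) '' Γ0);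 ∃ i : W ⟶ AlgebraicGeometry.Spec (.of (Localization.Away (Ideal.Quotient.mk I (∏ u ∈ Γp, (M.submatrix id u).det)))), AlgebraicGeometry.IsOpenImmersion j ∧ AlgebraicGeometry.IsOpenImmersion i ∧ AlgebraicGeometry.IsIntegral W ∧ (CategoryTheory.over (AlgebraicGeometry.AffineSpace (Fin s) Y) Y).base (j.base w) = y) := by
  intro h
  let Y : Scheme.{0} := Spec (.of (MvPolynomial (Fin 2) (ZMod 2) ⧸ Ideal.span {(MvPolynomial.X 0 * MvPolynomial.X 1 : MvPolynomial (Fin 2) (ZMod 2))}))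
  let f : Y ⟶ Spec (.of (ZMod 2)) := Spec.map (CommRingCat.ofHom (algebraMap (ZMod 2) (MvPolynomial (Fin 2) (ZMod 2) ⧸ Ideal.span {(MvPolynomial.X 0 * MvPolynomial.X 1 : MvPolynomial (Fin 2) (ZMod 2))})))
  have hft : LocallyOfFiniteType f := by
    rw [HasRingHomProperty.Spec_iff (P := @LocallyOfFiniteType)]
    show (algebraMap (ZMod 2) (MvPolynomial (Fin 2) (ZMod 2) ⧸ Ideal.span {(MvPolynomial.X 0 * MvPolynomial.X 1 : MvPolynomial (Fin 2) (ZMod 2))})).FiniteType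
    exact RingHom.finiteType_algebraMap.mpr inferInstance
  haveI : _root_.IsReduced (MvPolynomial (Fin 2) (ZMod 2) ⧸ Ideal.span {(MvPolynomial.X 0 * MvPolynomial.X 1 : MvPolynomial (Fin 2) (ZMod 2))}) := isReduced_nodeRing
  have hred : AlgebraicGeometry.IsReduced Y := inferInstance
  -- the origin: kernel of evaluation at `(0, 0)`
  let ev : (MvPolynomial (Fin 2) (ZMod 2) ⧸ Ideal.span {(MvPolynomial.X 0 * MvPolynomial.X 1 : MvPolynomial (Fin 2) (ZMod 2))}) →+* ZMod 2 :=
    Ideal.Quotient.lift _ (MvPolynomial.eval fun _ => (0 : ZMod 2))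
      (fun a ha => by
        rw [Ideal.mem_span_singleton] at ha
        obtain ⟨b, rfl⟩ := ha
        simp)
  let y₀ : PrimeSpectrum (MvPolynomial (Fin 2) (ZMod 2) ⧸ Ideal.span {(MvPolynomial.X 0 * MvPolynomial.X 1 : MvPolynomial (Fin 2) (ZMod 2))}) := ⟨RingHom.ker ev, RingHom.ker_isPrime ev⟩
  have hmem : ∀ i : Fin 2, Ideal.Quotient.mk _ (MvPolynomial.X i) ∈ y₀.asIdeal := fun i => by
    change Ideal.Quotient.mk _ (MvPolynomial.X i) ∈ RingHom.ker ev
    rw [RingHom.mem_ker]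
    simp [ev]
  obtain ⟨m, Γp, Γ0, s, W, j, w, i, hj, hi, hW, hwy⟩ :=
    h 2 Nat.prime_two Y f inferInstance hft inferInstance hred y₀
  exact false_of_isOpenImmersion_affineSpace_node s j w y₀ (hmem 0) (hmem 1) hwy

end Summit.ResolutionOfSingularities.ResolutionOfSingularities.Theorems.Universality.Negative

end
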